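import Literature.Algebra.Lie.LefschetzModule
import Literature.Algebra.Lie.LefschetzModulePolarization
import Mathlib.LinearAlgebra.Matrix.ToLin
import Mathlib.LinearAlgebra.Matrix.Notation
import Mathlib.LinearAlgebra.Matrix.BilinearForm
import HarnessLib

/-!
# Validation instance for Lefschetz modules: the `𝔰𝔩₂`-string of length two (Cattani, Example A.3.1, `n = 1`)

Topic `Literature/Algebra/Lie` (namespace `Literature.Algebra.Lie.LefschetzString`).  Lane `lit-hodgefound`, skeleton seat
`lit-hodgefound-skel-1` (generation 39), row **A1-95** of `run/shared/lean/pub/lit-hodgefound/SKELETON.md`: the VALIDATION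
INSTANCE V-A1-88c asked of the Layer-A referee for row A1-88 (`LefschetzModule.lean`), as tree theorems; §2 (generation 40,
row **A1-100**) is the validation instance V-A1-96d of row A1-96 (`LefschetzModulePolarization.lean`, Looijenga–Lunts (1.6)).  On `M = K²`
with the grading `h = diag(-1, 1)` (`M_{-1} = K δ₀`, `M_1 = K δ₁`) the raising operator `e : δ₀ ↦ δ₁` has the Lefschetz
property, and the CONSTRUCTED partner `HasLefschetzProperty.dual` of row A1-88 is the lowering operator `f : δ₁ ↦ δ₀`
(André's coefficient `j(k - j + 1) = 1` for `k = j = 1`).  Everything is obtained from row A1-88's (1.1) — the converse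
direction `hasLefschetzProperty_of_lie_eq` from the matrix identities `[e, f] = h`, `[h, e] = 2e`, `[h, f] = -2f`, and the
identification of the partner from the uniqueness clause `eq_dual_of_isSl2Triple` — so the instance exercises exactly
the interface a user of `LefschetzModule.lean` relies on.  Three `2 × 2` matrices are introduced as definitions with bodies;
no named fact, no `sorry`.  The commutator Lie ring of `𝔤𝔩(K²)` is Mathlib's reducible non-instance
`LieRing.ofAssociativeRing`, enabled file-locally as in `LefschetzModule.lean`.

Sources: Looijenga–Lunts, §1 (1.1) p. 4 L5–L24 (the assignment `(0 1; 0 0) ↦ e`, `(1 0; 0 -1) ↦ h`, `(0 0; 1 0) ↦ f`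
"defines a representation of `𝔰𝔩(2)`" — here in the LOWER-triangular convention, chosen so that "`e` of degree `2`" raises
the degree `δ₀ ∈ M_{-1} ↦ δ₁ ∈ M_1`; the standard upper-triangular triple with `δ₁ ∈ M_{-1}` would serve equally); Cattani (in Cattani–El Zein–Griffiths–Lê, *Hodge Theory*, App. A, held book p0059–p0060),
(A.3.1) `n_+ = (0 1; 0 0)`, `n_- = (0 0; 1 0)`, `y = (1 0; 0 -1)` and Example A.3.1 (the irreducible representation on
`ℂ^{n+1}` with `N_+(e_j) = μ_j e_{j+2}`).

## Contents (all proved)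

* `stringH = (-1 0; 0 1)`, `stringE = (0 0; 1 0)`, `stringF = (0 1; 0 0)` (defs) and the operators `Matrix.toLin'` of them;
  `lie_toLin'` (`[A, B] = AB - BA` as operators), the three relations `lie_stringE_stringF`, `lie_stringH_stringE`,
  `lie_stringH_stringF`; the degrees `single_zero_mem_degreeSpace` (`δ₀ ∈ M_{-1}`), `single_one_mem_degreeSpace`
  (`δ₁ ∈ M_1`), **`isZGrading_stringH`**; `toLin'_stringH_ne_zero`; **`isSl2Triple_string`**;
  **`hasLefschetzProperty_string`** (row A1-88 (1.1) "⇐"); **`dual_string_eq`** (the constructed partner is `f`);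
  `stringE_hasLefschetzProperty_iff` (sanity: (1.1) as an `iff` evaluates to `True` here).
* §2 (row A1-100, VALIDATION of row A1-96 = Looijenga–Lunts (1.6) "a polarization makes `(𝔞, M)` a Lefschetz module"):
  `stringΩ = (0 1; -1 0)` (def), the symplectic form `ω(x, y) = x₀ y₁ - x₁ y₀` = `Matrix.toBilin' stringΩ` on `K²`
  (`toBilin'_stringΩ_apply`, `nondegenerate_stringΩ`, `isRefl_stringΩ`), for which `h` and `e` are skew
  (`isSkewAdjoint_stringH`, `isSkewAdjoint_stringE`; coordinates `toLin'_stringH_apply`, `toLin'_stringE_apply`,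
  `apply_one_eq_zero_of_mem_degreeSpace`, `apply_zero_eq_zero_of_mem_degreeSpace`); with `J = 1` the operator `e`
  POLARIZES `(K², ω)` in the sense of row A1-96 (**`polarization_string`**: `ω(e^k m, m) ≠ 0` for non-zero `m ∈ P_{-k}`
  — only `P_{-1} = K δ₀` is non-zero, `ω(e δ₀, δ₀) = -1`), so `isLefschetzModule_of_polarization` applies:
  **`isLefschetzModule_string`** (`(K·e, K²)` IS a Lefschetz module in the sense of row A1-88 — the clause left open in
  the SCOPE of §1) and `isSemisimple_lefschetzLieAlgebra_string` (`𝔤(K·e, K²)` is semisimple) — every hypothesis of (1.6)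
  instantiated on a concrete object, none vacuous.

## References

* [LooijengaLunts1997] E. Looijenga, V. A. Lunts, *A Lie algebra attached to a projective variety*, Invent. Math. 129
  (1997) 361–412, §1 (1.1) p. 4; (1.6) pp. 5–6 (held `paper:arxiv-alg-geom_9604014` p0005 L59–p0006 L20).
* [CattaniElZeinGriffithsLe2014] E. Cattani et al. (eds.), *Hodge Theory*, Math. Notes 49, Princeton UP (2014), App. A,
  (A.3.1) and Example A.3.1 (held book pp. 59–60).
-/

noncomputable section

namespace Literature.Algebra.Lie.LefschetzString

open Module Function Set Literature.Algebra.Lie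

-- The commutator Lie ring of `𝔤𝔩(K²) = Module.End K (Fin 2 → K)`: Mathlib's reducible NON-instance, enabled file-locally
-- exactly as in `LefschetzModule.lean`.
attribute [local instance 100] LieRing.ofAssociativeRing

variable (K : Type*) [Field K]

/-- `h = diag(-1, 1)`: the grading of the string `K² = M_{-1} ⊕ M_1`. [cite: CattaniElZeinGriffithsLe2014, App. A (A.3.1) (y = (1 0; 0 −1), up to the order of the basis)] -/
def stringH : Matrix (Fin 2) (Fin 2) K := !![-1, 0; 0, 1]

/-- `e = (0 0; 1 0)`: the raising operator `δ₀ ↦ δ₁`, `δ₁ ↦ 0` (degree `2`). [cite: CattaniElZeinGriffithsLe2014, App. A (A.3.1) (n₋ = (0 0; 1 0))] -/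
def stringE : Matrix (Fin 2) (Fin 2) K := !![0, 0; 1, 0]

/-- `f = (0 1; 0 0)`: the lowering operator `δ₁ ↦ δ₀`, `δ₀ ↦ 0` (degree `-2`). [cite: CattaniElZeinGriffithsLe2014, App. A (A.3.1) (n₊ = (0 1; 0 0))] -/
def stringF : Matrix (Fin 2) (Fin 2) K := !![0, 1; 0, 0]

variable {K}

/-- Commutators of matrix operators are the operators of matrix commutators. [cite: LooijengaLunts1997, §1 (1.1) p. 4 ("defines a representation of 𝔰𝔩(2)")] -/
theorem lie_toLin' (A B : Matrix (Fin 2) (Fin 2) K) :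
    ⁅Matrix.toLin' A, Matrix.toLin' B⁆ = Matrix.toLin' (A * B - B * A) := by
  have h1 : ⁅Matrix.toLin' A, Matrix.toLin' B⁆ = Matrix.toLin' A * Matrix.toLin' B - Matrix.toLin' B * Matrix.toLin' A :=
    rfl
  rw [h1, Module.End.mul_eq_comp, Module.End.mul_eq_comp, ← Matrix.toLin'_mul, ← Matrix.toLin'_mul, ← map_sub]

/-- `[e, f] = h`. [cite: CattaniElZeinGriffithsLe2014, App. A (A.3.2)] -/
theorem lie_stringE_stringF : ⁅Matrix.toLin' (stringE K), Matrix.toLin' (stringF K)⁆ = Matrix.toLin' (stringH K) := by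
  rw [lie_toLin']
  congr 1
  ext i j
  fin_cases i <;> fin_cases j <;> norm_num [stringE, stringF, stringH, Matrix.mul_apply, Fin.sum_univ_two]

/-- `[h, e] = 2e`. [cite: CattaniElZeinGriffithsLe2014, App. A (A.3.2)] -/
theorem lie_stringH_stringE : ⁅Matrix.toLin' (stringH K), Matrix.toLin' (stringE K)⁆ = 2 • Matrix.toLin' (stringE K) := by
  rw [lie_toLin', ← map_nsmul]
  congr 1
  ext i j
  fin_cases i <;> fin_cases j <;> norm_num [stringE, stringH, Matrix.mul_apply, Fin.sum_univ_two]

/-- `[h, f] = -2f`. [cite: CattaniElZeinGriffithsLe2014, App. A (A.3.2)] -/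
theorem lie_stringH_stringF :
    ⁅Matrix.toLin' (stringH K), Matrix.toLin' (stringF K)⁆ = -(2 • Matrix.toLin' (stringF K)) := by
  rw [lie_toLin', ← map_nsmul, ← map_neg]
  congr 1
  ext i j
  fin_cases i <;> fin_cases j <;> norm_num [stringF, stringH, Matrix.mul_apply, Fin.sum_univ_two]

/-- `h δ₀ = -δ₀`: the basis vector `δ₀` has degree `-1`. [cite: LooijengaLunts1997, §1 (1.1) p. 3 ("multiplication by k in degree k")] -/
theorem single_zero_mem_degreeSpace : (Pi.single 0 1 : Fin 2 → K) ∈ degreeSpace (Matrix.toLin' (stringH K)) (-1) := by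
  rw [mem_degreeSpace_iff, Matrix.toLin'_apply]
  funext i
  fin_cases i <;> simp [stringH, Matrix.mulVec, dotProduct, Fin.sum_univ_two]

/-- `h δ₁ = δ₁`: the basis vector `δ₁` has degree `1`. [cite: LooijengaLunts1997, §1 (1.1) p. 3] -/
theorem single_one_mem_degreeSpace : (Pi.single 1 1 : Fin 2 → K) ∈ degreeSpace (Matrix.toLin' (stringH K)) 1 := by
  rw [mem_degreeSpace_iff, Matrix.toLin'_apply]
  funext i
  fin_cases i <;> simp [stringH, Matrix.mulVec, dotProduct, Fin.sum_univ_two]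

/-- **`(K², h)` is `ℤ`-graded**: `K² = M_{-1} ⊕ M_1`. [cite: LooijengaLunts1997, §1 (1.1) p. 3] -/
theorem isZGrading_stringH : IsZGrading (Matrix.toLin' (stringH K)) := by
  rw [IsZGrading, eq_top_iff]
  rintro v -
  have hv : v = v 0 • (Pi.single 0 1 : Fin 2 → K) + v 1 • (Pi.single 1 1 : Fin 2 → K) := by
    funext i
    fin_cases i <;> simp
  rw [hv]
  exact Submodule.add_mem _
    (Submodule.mem_iSup_of_mem (-1) (Submodule.smul_mem _ _ single_zero_mem_degreeSpace))
    (Submodule.mem_iSup_of_mem 1 (Submodule.smul_mem _ _ single_one_mem_degreeSpace))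

/-- `h ≠ 0` (`h δ₁ = δ₁`). [cite: LooijengaLunts1997, §1 (1.1) p. 4] -/
theorem toLin'_stringH_ne_zero : Matrix.toLin' (stringH K) ≠ 0 := by
  intro h0
  have h1 := mem_degreeSpace_iff.1 (single_one_mem_degreeSpace (K := K))
  rw [h0, LinearMap.zero_apply, Int.cast_one, one_smul] at h1
  exact one_ne_zero (congr_fun h1.symm 1 |>.trans (by simp))

/-- **`(e, h, f)` is an `𝔰𝔩₂`-triple in `𝔤𝔩(K²)`.** [cite: LooijengaLunts1997, §1 (1.1) p. 4 L5–L24] [cite: CattaniElZeinGriffithsLe2014, App. A (A.3.1)–(A.3.2)] -/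
theorem isSl2Triple_string :
    IsSl2Triple (Matrix.toLin' (stringH K)) (Matrix.toLin' (stringE K)) (Matrix.toLin' (stringF K)) where
  h_ne_zero := toLin'_stringH_ne_zero
  lie_e_f := lie_stringE_stringF
  lie_h_e_nsmul := lie_stringH_stringE
  lie_h_f_nsmul := lie_stringH_stringF

variable [CharZero K]

/-- **VALIDATION of row A1-88: `e` has the Lefschetz property on `(K², h)`** — obtained from (1.1) "⇐"
(`hasLefschetzProperty_of_lie_eq`) and the three matrix identities. [cite: LooijengaLunts1997, §1 (1.1) p. 4 L1–L5]
[cite: CattaniElZeinGriffithsLe2014, App. A Example A.3.1] -/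
theorem hasLefschetzProperty_string : HasLefschetzProperty (Matrix.toLin' (stringH K)) (Matrix.toLin' (stringE K)) :=
  hasLefschetzProperty_of_lie_eq isZGrading_stringH lie_stringH_stringE lie_stringH_stringF lie_stringE_stringF

/-- **VALIDATION of row A1-88's CONSTRUCTED partner: `dual = f`** (André's `ᶜΛ` on the string of length two is the
lowering operator; uniqueness (1.1)). [cite: LooijengaLunts1997, §1 (1.1) p. 4 L4 ("This f is then unique")] [cite: CattaniElZeinGriffithsLe2014, App. A Example A.3.1] -/
theorem dual_string_eq :
    (hasLefschetzProperty_string (K := K)).dual isZGrading_stringH = Matrix.toLin' (stringF K) :=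
  ((hasLefschetzProperty_string (K := K)).eq_dual_of_isSl2Triple isZGrading_stringH isSl2Triple_string).symm

/-- Sanity: row A1-88's equivalence (1.1) evaluated on the string. [cite: LooijengaLunts1997, §1 (1.1) p. 4 L1–L5] -/
theorem stringE_hasLefschetzProperty_iff :
    HasLefschetzProperty (Matrix.toLin' (stringH K)) (Matrix.toLin' (stringE K)) ↔
      ∃ f : Module.End K (Fin 2 → K), IsSl2Triple (Matrix.toLin' (stringH K)) (Matrix.toLin' (stringE K)) f :=
  hasLefschetzProperty_iff_exists_isSl2Triple isZGrading_stringH toLin'_stringH_ne_zero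

/-! ### §2 Validation of row A1-96 ((1.6)): the string as a POLARIZED Lefschetz module (`φ = ω`, `J = 1`) -/

section Polarized

variable (K) in
/-- `ω = (0 1; -1 0)`: the matrix of the symplectic form `ω(x, y) = x₀ y₁ - x₁ y₀` on the string `K²` — the invariant
`(-)^k`-symmetric form of `V(k)`, `k = 1` ("the `𝔰𝔩₂`-invariant bilinear forms on `V(k)` are generated by a nonzero
`(-)^k`-symmetric form"). [cite: LooijengaLunts1997, §1 (1.16) p0008 L77–L79 ("the 𝔰𝔩(2)-invariant bilinear forms on V(k) are generated by a nonzero (−)^k-symmetric form")] -/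
def stringΩ : Matrix (Fin 2) (Fin 2) K := !![0, 1; -1, 0]

omit [CharZero K] in
/-- `ω(x, y) = x₀ y₁ - x₁ y₀`. [cite: LooijengaLunts1997, §1 (1.16) p0008 L77–L79 ("the 𝔰𝔩(2)-invariant bilinear forms on V(k) are generated by a nonzero (−)^k-symmetric form")] -/
theorem toBilin'_stringΩ_apply (x y : Fin 2 → K) : Matrix.toBilin' (stringΩ K) x y = x 0 * y 1 - x 1 * y 0 := by
  rw [Matrix.toBilin'_apply]
  simp [Fin.sum_univ_two, stringΩ]
  ring

omit [CharZero K] in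
/-- `h(x₀, x₁) = (-x₀, x₁)`. [cite: CattaniElZeinGriffithsLe2014, App. A (A.3.1)] -/
theorem toLin'_stringH_apply (x : Fin 2 → K) : Matrix.toLin' (stringH K) x = ![-x 0, x 1] := by
  rw [Matrix.toLin'_apply]
  funext i
  fin_cases i <;> simp [stringH, Matrix.mulVec, dotProduct, Fin.sum_univ_two]

omit [CharZero K] in
/-- `e(x₀, x₁) = (0, x₀)`. [cite: CattaniElZeinGriffithsLe2014, App. A (A.3.1)] -/
theorem toLin'_stringE_apply (x : Fin 2 → K) : Matrix.toLin' (stringE K) x = ![0, x 0] := by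
  rw [Matrix.toLin'_apply]
  funext i
  fin_cases i <;> simp [stringE, Matrix.mulVec, dotProduct, Fin.sum_univ_two]

omit [CharZero K] in
/-- `ω` is non-degenerate ("a nondegenerate `(-)^d`-symmetric form `φ`" of (1.6), `d = 1`). [cite: LooijengaLunts1997, §1 (1.6) p0005 L59–L60] -/
theorem nondegenerate_stringΩ : (Matrix.toBilin' (stringΩ K)).Nondegenerate := by
  refine ⟨fun x hx ↦ ?_, fun y hy ↦ ?_⟩
  · have h0 := hx (Pi.single 1 1)
    have h1 := hx (Pi.single 0 1)
    rw [toBilin'_stringΩ_apply] at h0 h1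
    simp at h0 h1
    funext i
    fin_cases i <;> simp [h0, h1]
  · have h0 := hy (Pi.single 1 1)
    have h1 := hy (Pi.single 0 1)
    rw [toBilin'_stringΩ_apply] at h0 h1
    simp at h0 h1
    funext i
    fin_cases i <;> simp [h0, h1]

omit [CharZero K] in
/-- `ω` is alternating, hence reflexive. [cite: LooijengaLunts1997, §1 (1.6) p0005 L59–L60 ("(−)^d-symmetric")] -/
theorem isRefl_stringΩ : (Matrix.toBilin' (stringΩ K)).IsRefl := by
  intro x y hxy
  rw [toBilin'_stringΩ_apply] at hxy ⊢
  linear_combination -hxy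

omit [CharZero K] in
/-- `h` preserves `ω` infinitesimally ("`φ` is zero on `M_k × M_l` unless `k + l = 0`": `ω(δ₀, δ₀) = ω(δ₁, δ₁) = 0`).
[cite: LooijengaLunts1997, §1 (1.3) p0005 L3–L4] -/
theorem isSkewAdjoint_stringH : (Matrix.toBilin' (stringΩ K)).IsSkewAdjoint (Matrix.toLin' (stringH K)) := by
  intro x y
  rw [Pi.neg_apply, map_neg, toBilin'_stringΩ_apply, toBilin'_stringΩ_apply, toLin'_stringH_apply, toLin'_stringH_apply]
  simp
  ring

omit [CharZero K] in
/-- `e` preserves `ω` infinitesimally (`e ∈ 𝔰𝔭(ω) = 𝔰𝔩₂`). [cite: LooijengaLunts1997, §1 (1.3) p0005 L4–L6] -/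
theorem isSkewAdjoint_stringE : (Matrix.toBilin' (stringΩ K)).IsSkewAdjoint (Matrix.toLin' (stringE K)) := by
  intro x y
  rw [Pi.neg_apply, map_neg, toBilin'_stringΩ_apply, toBilin'_stringΩ_apply, toLin'_stringE_apply, toLin'_stringE_apply]
  simp

/-- A vector of degree `-k ≤ 0` has no `δ₁`-component (`δ₁ ∈ M_1`; characteristic `0`). [cite: CattaniElZeinGriffithsLe2014, App. A Example A.3.1] -/
theorem apply_one_eq_zero_of_mem_degreeSpace {k : ℕ} {m : Fin 2 → K}
    (hm : m ∈ degreeSpace (Matrix.toLin' (stringH K)) (-(k : ℤ))) : m 1 = 0 := by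
  rw [mem_degreeSpace_iff, toLin'_stringH_apply] at hm
  have h1 := congr_fun hm 1
  simp at h1
  -- h1 : m 1 = -(k * m 1)
  have h2 : ((k : K) + 1) * m 1 = 0 := by linear_combination h1
  exact (mul_eq_zero.1 h2).resolve_left (by exact_mod_cast Nat.succ_ne_zero k)

/-- … and no `δ₀`-component unless `k = 1` (`δ₀ ∈ M_{-1}`). [cite: CattaniElZeinGriffithsLe2014, App. A Example A.3.1] -/
theorem apply_zero_eq_zero_of_mem_degreeSpace {k : ℕ} (hk : k ≠ 1) {m : Fin 2 → K}
    (hm : m ∈ degreeSpace (Matrix.toLin' (stringH K)) (-(k : ℤ))) : m 0 = 0 := by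
  rw [mem_degreeSpace_iff, toLin'_stringH_apply] at hm
  have h1 := congr_fun hm 0
  simp at h1
  -- h1 : -m 0 = -(k * m 0) or m 0 = k * m 0
  have h2 : ((k : K) - 1) * m 0 = 0 := by linear_combination -h1
  refine (mul_eq_zero.1 h2).resolve_left fun h3 ↦ hk ?_
  exact_mod_cast (sub_eq_zero.1 h3)

/-- **`e` polarizes `(K², ω)` with `J = 1`** in the sense of row A1-96 (hypothesis `hpol` of
`isLefschetzModule_of_polarization`: "`H^k_e` is definite on `Ker(e^{k+1} | M_{-k})`" on the primitive vectors):
`ω(e^k m, m) = 0` only for `m = 0` when `m ∈ P_{-k}` — all `P_{-k}` vanish except `P_{-1} = K δ₀`, where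
`ω(e δ₀, δ₀) = ω(δ₁, δ₀) = -1`. [cite: LooijengaLunts1997, §1 (1.6) p0005 L73–L74, L82] -/
theorem polarization_string (k : ℕ) (m : Fin 2 → K)
    (hm : m ∈ HasLefschetzProperty.primitiveSpace (Matrix.toLin' (stringH K)) (Matrix.toLin' (stringE K)) k)
    (h0 : Matrix.toBilin' (stringΩ K) ((Matrix.toLin' (stringE K) ^ k) m) ((1 : Module.End K (Fin 2 → K)) m) = 0) :
    m = 0 := by
  obtain ⟨hdeg, -⟩ := HasLefschetzProperty.mem_primitiveSpace_iff.1 hm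
  have h1 : m 1 = 0 := apply_one_eq_zero_of_mem_degreeSpace hdeg
  by_cases hk : k = 1
  · subst hk
    rw [pow_one, Module.End.one_apply, toBilin'_stringΩ_apply, toLin'_stringE_apply] at h0
    simp [h1] at h0
    funext i
    fin_cases i <;> simp [h0, h1]
  · have h2 : m 0 = 0 := apply_zero_eq_zero_of_mem_degreeSpace hk hdeg
    funext i
    fin_cases i <;> simp [h1, h2]

/-- **VALIDATION of row A1-96 (Looijenga–Lunts (1.6)) on the string: `(K·e, K²)` IS a Lefschetz module** in the sense
of row A1-88 (`IsLefschetzModule`: graded, `𝔞 = K·e ⊆ 𝔤𝔩(K²)₂` abelian with a Lefschetz element, `𝔤(K·e, K²)` semisimple),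
obtained by `isLefschetzModule_of_polarization` with `φ = ω`, `J = 1` (which commutes with everything and preserves `ω`)
and the polarizing element `a = e` — every hypothesis of the abstract (1.6) holds here, so none is vacuous; this also
settles the clause "`IsLefschetzModule` for `(K·e, K²)`" left open in §1. [cite: LooijengaLunts1997, §1 (1.6) Proposition p0005 L76–L84] [cite: CattaniElZeinGriffithsLe2014, App. A Example A.3.1] -/
theorem isLefschetzModule_string :
    IsLefschetzModule K (Matrix.toLin' (stringH K)) (K ∙ Matrix.toLin' (stringE K)) := by
  have h𝔞 : (K ∙ Matrix.toLin' (stringE K)) ≤ adDegree K (Matrix.toLin' (stringH K)) 2 := by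
    rw [Submodule.span_le, Set.singleton_subset_iff, SetLike.mem_coe, mem_adDegree_iff, lie_stringH_stringE, two_smul,
      two_smul]
  refine isLefschetzModule_of_polarization (B := Matrix.toBilin' (stringΩ K)) (J := 1) isZGrading_stringH
    toLin'_stringH_ne_zero nondegenerate_stringΩ isRefl_stringΩ isSkewAdjoint_stringH h𝔞 ?_ ?_ (Commute.one_left _)
    (fun a _ ↦ Commute.one_left a) (fun x y ↦ rfl) (Submodule.mem_span_singleton_self _) polarization_string
  · intro a ha b hb
    obtain ⟨c, rfl⟩ := Submodule.mem_span_singleton.1 ha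
    obtain ⟨d, rfl⟩ := Submodule.mem_span_singleton.1 hb
    rw [smul_lie, lie_smul, lie_self, smul_zero, smul_zero]
  · intro a ha
    obtain ⟨c, rfl⟩ := Submodule.mem_span_singleton.1 ha
    intro x y
    have h1 := isSkewAdjoint_stringE (K := K) x y
    rw [Pi.neg_apply, map_neg] at h1 ⊢
    rw [LinearMap.smul_apply, LinearMap.smul_apply, map_smul, LinearMap.smul_apply, map_smul, smul_eq_mul, smul_eq_mul,
      h1, mul_neg]

/-- … in particular **`𝔤(K·e, K²)` (`= 𝔰𝔩₂`) is semisimple**, by (1.6). [cite: LooijengaLunts1997, §1 (1.6) Proposition p0005 L83–L84] -/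
theorem isSemisimple_lefschetzLieAlgebra_string :
    LieAlgebra.IsSemisimple K (lefschetzLieAlgebra K (Matrix.toLin' (stringH K)) (K ∙ Matrix.toLin' (stringE K))) :=
  isLefschetzModule_string.isSemisimple

end Polarized

end Literature.Algebra.Lie.LefschetzString

end
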